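import Summits.QuantumFields.GaugeBoot.PlanarCertificateSoundnessZd
import Summits.QuantumFields.GaugeBoot.PlanarCertificateSoundnessTorus
import HarnessLib

/-!
# The orientation-resolved relaxation block: read through the REVERSED second loop, Kazakov–Zheng's `[[1, Wᵀ], [W, Q]] ⪰ 0` holds EXACTLY at every finite `N` (gauge-boot, large-`N` supplement 15)

HONEST FRAMING (cell `pub-gaugeboot`, page 1 of every file): the venture produces certified bounds
on lattice expectations at stated coupling, gauge group, dimension and torus size; NOT a mass gap,
NOT a continuum limit, NOT a string tension; NOT large `N` unless marked CONDITIONAL; NOT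
Yang–Mills-summit-bearing (barriers `FixedCouplingUltralocality`, `PerturbativeInvisibility`).
Pure algebra / probability plus the lane's loop-data dictionary; this file certifies no number.

## What this is

Supplement 1 (`PlanarRelaxationBlock`) read Kazakov–Zheng's convex relaxation (arXiv:2203.11360 §3.2)
at finite `N` with the pair variable of the planar loop equations, `Q(A, B) = Re E[t_A t_B]`
(`t_C = tr ρ(hol C)/N`), and found the defect `−E(Σ_A m_A Im t_A)²`: for a rank-one multiplier
`m mᵀ`, `⟨m mᵀ, [[1, Wᵀ], [W, Q]]⟩ = E(m₀ + Σ m_A Re t_A)² − E(Σ m_A Im t_A)²`.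

This file makes the elementary but decisive observation that the defect is an artefact of WIRING,
not of finite `N`.  Read the block entry `(A, B)` through the REVERSED second loop,
`Q(ℓ_A, ℓ_B⁻¹) = Re E[t_A t_{B⁻¹}] = Re E[t_A conj t_B]` (reversal conjugates the trace on a compact
group, `PlanarLoopDataZd.loopTrZd_reverse`).  Then, for ANY complex random variables bounded by `1`,

`⟨m mᵀ, [[1, Wᵀ], [W, Q^↺]]⟩ = E(m₀ + Σ_A m_A Re t_A)² + E(Σ_A m_A Im t_A)² = E|m₀ + Σ_A m_A t_A|² ≥ 0`

(`shorPairing_re_conj_eq`, `shorPairing_re_conj_eq_normSq`, `shorPairing_integral_conj_eq`): the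
ORIENTATION-RESOLVED relaxation block is positive semi-definite ON THE NOSE at every `N`, for every
state, every coupling, every compact gauge group (`isRelaxationFeasible_integral_conj`,
`isRelaxationFeasible_loopData_resolved`, torus: `isRelaxationFeasible_loopDataT_resolved`).  It is the
second-moment (Gram) matrix of the complex vector `(1, t_{ℓ_A})_A` — one of the multi-trace positivity
matrices of the finite-`N` bootstrap (Kazakov–Zheng arXiv:2404.16925 §3.1; the lane's `LoopPositivity`).

The two readings differ by exactly `2 E(Σ_A m_A Im t_A)²` (`shorPairing_integral_conj_sub`,
`shorPairing_loopData_resolved_sub`): at `N = ∞`, where `W[C⁻¹] = W[C]` is real and the block is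
factorised, they coincide, and a planar certificate cannot tell them apart; at finite `N` the planar
format's relaxation defect is PRECISELY the price of identifying `Q(ℓ_A, ℓ_B)` with `Q(ℓ_A, ℓ_B⁻¹)` —
a SEPARATE orientation reversal of one member of a pair (supplement 2's
`loopQ_sub_loopQ_reverse`: `Q(A,B) − Q(A,B⁻¹) = −2 Γ(A,B)`).  The sequel
`PlanarCertificateResolvedSoundness` turns this into the exact finite-`N` soundness of
orientation-resolved planar certificates for `U(N)`.

Also the functional (word-truncated bootstrap) form: for a linear `φ` non-negative on squares,
`Q_{AB} = φ(a_A a_B + b_A b_B)` gives `φ((m₀ + Σ m a)²) + φ((Σ m b)²) ≥ 0` (`shorPairing_apply_conj_eq`).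

References: Kazakov–Zheng arXiv:2203.11360 §3.2 (the relaxation), arXiv:2404.16925 §3.1 (multi-trace
positivity at finite `N`); the finite-`N` readings are [folklore] algebra.
-/

noncomputable section

open MeasureTheory
open scoped BigOperators
open Literature.Probability.LatticeModels (Site)
open Literature.MathematicalPhysics.QuantumLattice


namespace Summit.QuantumFields.GaugeBoot

variable {ι : Type*} [Fintype ι]

/-! ## The pairing is affine in `Q`: two readings differ by the multiplier paired with their difference -/

/-- **Affinity in the pair variables**: `⟨m mᵀ, Shor(W, Q₁)⟩ − ⟨m mᵀ, Shor(W, Q₂)⟩ = Σ_{A,B} m_A m_B (Q₁ − Q₂)(A, B)`.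
[folklore] -/
theorem shorPairing_sub_shorPairing (m₀ : ℝ) (m : ι → ℝ) (W : ι → ℝ) (Q₁ Q₂ : ι → ι → ℝ) :
    shorPairing m₀ m W Q₁ - shorPairing m₀ m W Q₂ = ∑ A, ∑ B, m A * m B * (Q₁ A B - Q₂ A B) := by
  simp only [shorPairing, mul_sub, Finset.sum_sub_distrib]
  ring

/-! ## Pointwise: the Hermitian reading `Q_{AB} = Re(t_A conj t_B)` is a modulus squared -/

/-- **The orientation-resolved reading, pointwise**: for complex numbers `t_A`, with `W_A = Re t_A`
and `Q_{AB} = Re(t_A conj t_B) = Re t_A Re t_B + Im t_A Im t_B`,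
`⟨m mᵀ, [[1, Wᵀ], [W, Q]]⟩ = (m₀ + Σ_A m_A Re t_A)² + (Σ_A m_A Im t_A)²`. [folklore] -/
theorem shorPairing_re_conj_eq (m₀ : ℝ) (m : ι → ℝ) (t : ι → ℂ) :
    shorPairing m₀ m (fun A => (t A).re) (fun A B => (t A * starRingEnd ℂ (t B)).re) =
      (m₀ + ∑ A, m A * (t A).re) ^ 2 + (∑ A, m A * (t A).im) ^ 2 := by
  have h : ∑ A, ∑ B, m A * m B * (t A * starRingEnd ℂ (t B)).re =
      (∑ A, m A * (t A).re) ^ 2 + (∑ A, m A * (t A).im) ^ 2 := by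
    rw [← sum_sum_mul_mul_eq_sq, ← sum_sum_mul_mul_eq_sq, ← Finset.sum_add_distrib]
    refine Finset.sum_congr rfl fun A _ => ?_
    rw [← Finset.sum_add_distrib]
    refine Finset.sum_congr rfl fun B _ => ?_
    rw [Complex.mul_re, Complex.conj_re, Complex.conj_im]
    ring
  rw [shorPairing, h]
  ring

/-- **… i.e. the modulus squared `|m₀ + Σ_A m_A t_A|²`** of a complex affine combination of the loop
variables. [folklore] -/
theorem shorPairing_re_conj_eq_normSq (m₀ : ℝ) (m : ι → ℝ) (t : ι → ℂ) :
    shorPairing m₀ m (fun A => (t A).re) (fun A B => (t A * starRingEnd ℂ (t B)).re) =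
      Complex.normSq ((m₀ : ℂ) + ∑ A, (m A : ℂ) * t A) := by
  rw [shorPairing_re_conj_eq, Complex.normSq_apply]
  have hre : ((m₀ : ℂ) + ∑ A, (m A : ℂ) * t A).re = m₀ + ∑ A, m A * (t A).re := by
    rw [Complex.add_re, Complex.ofReal_re, Complex.re_sum]
    simp_rw [Complex.re_ofReal_mul]
  have him : ((m₀ : ℂ) + ∑ A, (m A : ℂ) * t A).im = ∑ A, m A * (t A).im := by
    rw [Complex.add_im, Complex.ofReal_im, Complex.im_sum, zero_add]
    simp_rw [Complex.im_ofReal_mul]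
  rw [hre, him]
  ring

/-- Hence the orientation-resolved reading is non-negative pointwise. [folklore] -/
theorem shorPairing_re_conj_nonneg (m₀ : ℝ) (m : ι → ℝ) (t : ι → ℂ) :
    0 ≤ shorPairing m₀ m (fun A => (t A).re) (fun A B => (t A * starRingEnd ℂ (t B)).re) := by
  rw [shorPairing_re_conj_eq]; positivity

/-- **The two readings differ by twice the imaginary square**, pointwise:
`⟨m mᵀ, Shor(Re t, Re(t conj t))⟩ − ⟨m mᵀ, Shor(Re t, Re(t t))⟩ = 2 (Σ_A m_A Im t_A)²`. [folklore] -/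
theorem shorPairing_re_conj_sub_re (m₀ : ℝ) (m : ι → ℝ) (t : ι → ℂ) :
    shorPairing m₀ m (fun A => (t A).re) (fun A B => (t A * starRingEnd ℂ (t B)).re) -
        shorPairing m₀ m (fun A => (t A).re) (fun A B => (t A * t B).re) =
      2 * (∑ A, m A * (t A).im) ^ 2 := by
  rw [shorPairing_re_conj_eq, shorPairing_re_eq]; ring

/-! ## States: `W = Re E t`, `Q^↺ = Re E[t conj t]` -/

section Measure

variable {Ω : Type*} [MeasurableSpace Ω] {μ : Measure Ω} [IsProbabilityMeasure μ]

/-- **The pairing passes inside the expectation for ANY bounded pair observables** `q_{AB}`: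
with `W_A = Re E t_A`, `Q_{AB} = Re E q_{AB}`, `⟨m mᵀ, Shor(W, Q)⟩ = E ⟨m mᵀ, Shor(Re t, Re q)⟩`
(affinity; supplement 1 proved the instance `q_{AB} = t_A t_B`). [folklore] -/
theorem shorPairing_integral_eq_integral_of_pair (m₀ : ℝ) (m : ι → ℝ) {t : ι → Ω → ℂ} {q : ι → ι → Ω → ℂ}
    (hm : ∀ A, AEStronglyMeasurable (t A) μ) (hb : ∀ A ω, ‖t A ω‖ ≤ 1)
    (hqm : ∀ A B, AEStronglyMeasurable (q A B) μ) (hqb : ∀ A B ω, ‖q A B ω‖ ≤ 1) :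
    shorPairing m₀ m (fun A => (∫ ω, t A ω ∂μ).re) (fun A B => (∫ ω, q A B ω ∂μ).re) =
      ∫ ω, shorPairing m₀ m (fun A => (t A ω).re) (fun A B => (q A B ω).re) ∂μ := by
  have hiA : ∀ A, Integrable (t A) μ := fun A => integrable_of_norm_le_one μ (hm A) (hb A)
  have hiAB : ∀ A B, Integrable (q A B) μ := fun A B => integrable_of_norm_le_one μ (hqm A B) (hqb A B)
  have hre : ∀ A, (∫ ω, t A ω ∂μ).re = ∫ ω, (t A ω).re ∂μ := fun A => by
    have h := integral_re (hiA A); simp only [RCLike.re_to_complex] at h; exact h.symm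
  have hre2 : ∀ A B, (∫ ω, q A B ω ∂μ).re = ∫ ω, (q A B ω).re ∂μ := fun A B => by
    have h := integral_re (hiAB A B); simp only [RCLike.re_to_complex] at h; exact h.symm
  have hiRe : ∀ A, Integrable (fun ω => (t A ω).re) μ := fun A => (hiA A).re
  have hiRe2 : ∀ A B, Integrable (fun ω => (q A B ω).re) μ := fun A B => (hiAB A B).re
  have hW : Integrable (fun ω => ∑ A, (2 * m₀ * m A) * (t A ω).re) μ :=
    integrable_finsetSum _ fun A _ => (hiRe A).const_mul _
  have hQ : Integrable (fun ω => ∑ A, ∑ B, (m A * m B) * (q A B ω).re) μ :=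
    integrable_finsetSum _ fun A _ => integrable_finsetSum _ fun B _ => (hiRe2 A B).const_mul _
  have hCW : Integrable (fun ω => m₀ ^ 2 + ∑ A, (2 * m₀ * m A) * (t A ω).re) μ := (integrable_const _).add hW
  have e1 : ∫ ω, (m₀ ^ 2 + ∑ A, (2 * m₀ * m A) * (t A ω).re + ∑ A, ∑ B, (m A * m B) * (q A B ω).re) ∂μ =
      (∫ ω, (m₀ ^ 2 + ∑ A, (2 * m₀ * m A) * (t A ω).re) ∂μ) + ∫ ω, ∑ A, ∑ B, (m A * m B) * (q A B ω).re ∂μ :=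
    integral_add hCW hQ
  have e2 : ∫ ω, (m₀ ^ 2 + ∑ A, (2 * m₀ * m A) * (t A ω).re) ∂μ = m₀ ^ 2 + ∫ ω, ∑ A, (2 * m₀ * m A) * (t A ω).re ∂μ := by
    rw [integral_add (integrable_const _) hW, integral_const]
    simp
  have e3 : ∫ ω, ∑ A, (2 * m₀ * m A) * (t A ω).re ∂μ = ∑ A, (2 * m₀ * m A) * (∫ ω, t A ω ∂μ).re := by
    rw [integral_finsetSum _ fun A _ => (hiRe A).const_mul _]
    exact Finset.sum_congr rfl fun A _ => by rw [integral_const_mul, hre]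
  have e4 : ∫ ω, ∑ A, ∑ B, (m A * m B) * (q A B ω).re ∂μ = ∑ A, ∑ B, (m A * m B) * (∫ ω, q A B ω ∂μ).re := by
    rw [integral_finsetSum _ fun A _ => integrable_finsetSum _ fun B _ => (hiRe2 A B).const_mul _]
    refine Finset.sum_congr rfl fun A _ => ?_
    rw [integral_finsetSum _ fun B _ => (hiRe2 A B).const_mul _]
    exact Finset.sum_congr rfl fun B _ => by rw [integral_const_mul, hre2]
  simp_rw [shorPairing_eq_sum]
  rw [e1, e2, e3, e4]

/-- `‖t_A conj t_B‖ ≤ 1` for `‖t_A‖, ‖t_B‖ ≤ 1`. [folklore] -/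
theorem norm_mul_conj_le_one {a b : ℂ} (ha : ‖a‖ ≤ 1) (hb : ‖b‖ ≤ 1) : ‖a * starRingEnd ℂ b‖ ≤ 1 := by
  refine norm_mul_le_one_of_norm_le_one ha ?_
  rw [Complex.norm_conj]; exact hb

/-- **THE ORIENTATION-RESOLVED RELAXATION BLOCK AT FINITE `N` (states)**: for complex observables `t_A`
bounded by `1` on a probability space, with `W_A = Re E t_A` and the HERMITIAN pair expectation
`Q_{AB} = Re E[t_A conj t_B]`,
`⟨m mᵀ, [[1, Wᵀ], [W, Q]]⟩ = E(m₀ + Σ_A m_A Re t_A)² + E(Σ_A m_A Im t_A)²`. [folklore] -/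
theorem shorPairing_integral_conj_eq (m₀ : ℝ) (m : ι → ℝ) {t : ι → Ω → ℂ}
    (hm : ∀ A, AEStronglyMeasurable (t A) μ) (hb : ∀ A ω, ‖t A ω‖ ≤ 1) :
    shorPairing m₀ m (fun A => (∫ ω, t A ω ∂μ).re) (fun A B => (∫ ω, t A ω * starRingEnd ℂ (t B ω) ∂μ).re) =
      (∫ ω, (m₀ + ∑ A, m A * (t A ω).re) ^ 2 ∂μ) + ∫ ω, (∑ A, m A * (t A ω).im) ^ 2 ∂μ := by
  rw [shorPairing_integral_eq_integral_of_pair m₀ m (q := fun A B ω => t A ω * starRingEnd ℂ (t B ω)) hm hb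
    (fun A B => (hm A).mul (Complex.continuous_conj.comp_aestronglyMeasurable (hm B)))
    (fun A B ω => norm_mul_conj_le_one (hb A ω) (hb B ω))]
  simp_rw [shorPairing_re_conj_eq]
  exact integral_add (integrable_sq_affine_re m₀ m hm hb) (integrable_sq_sum_im m hm hb)

/-- **Hence it is non-negative: NO defect.** [folklore] -/
theorem shorPairing_integral_conj_nonneg (m₀ : ℝ) (m : ι → ℝ) {t : ι → Ω → ℂ}
    (hm : ∀ A, AEStronglyMeasurable (t A) μ) (hb : ∀ A ω, ‖t A ω‖ ≤ 1) :
    0 ≤ shorPairing m₀ m (fun A => (∫ ω, t A ω ∂μ).re) (fun A B => (∫ ω, t A ω * starRingEnd ℂ (t B ω) ∂μ).re) := by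
  rw [shorPairing_integral_conj_eq m₀ m hm hb]
  exact add_nonneg (integral_nonneg fun ω => sq_nonneg _) (integral_nonneg fun ω => sq_nonneg _)

/-- ★★ **Kazakov–Zheng's relaxation is EXACTLY feasible, for any complex bounded observables on any
probability space, when the pair variable is the Hermitian pair expectation** `Re E[t_A conj t_B]`:
the block `[[1, Wᵀ], [W, Q]]` is then the (real part of the) Gram matrix of `(1, t_A)_A` in `L²(μ)`.
[folklore] -/
theorem isRelaxationFeasible_integral_conj {t : ι → Ω → ℂ}
    (hm : ∀ A, AEStronglyMeasurable (t A) μ) (hb : ∀ A ω, ‖t A ω‖ ≤ 1) :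
    IsRelaxationFeasible (fun A => (∫ ω, t A ω ∂μ).re) (fun A B => (∫ ω, t A ω * starRingEnd ℂ (t B ω) ∂μ).re) :=
  fun m₀ m => shorPairing_integral_conj_nonneg m₀ m hm hb

/-- **The two readings of a state differ by twice the imaginary-part second moment**:
`⟨m mᵀ, Shor(W, Re E[t conj t])⟩ − ⟨m mᵀ, Shor(W, Re E[t t])⟩ = 2 E(Σ_A m_A Im t_A)²` — the planar
format's relaxation defect (supplement 1) is exactly the price of wiring `(A, B)` instead of
`(A, B⁻¹)`. [folklore] -/
theorem shorPairing_integral_conj_sub (m₀ : ℝ) (m : ι → ℝ) {t : ι → Ω → ℂ}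
    (hm : ∀ A, AEStronglyMeasurable (t A) μ) (hb : ∀ A ω, ‖t A ω‖ ≤ 1) :
    shorPairing m₀ m (fun A => (∫ ω, t A ω ∂μ).re) (fun A B => (∫ ω, t A ω * starRingEnd ℂ (t B ω) ∂μ).re) -
        shorPairing m₀ m (fun A => (∫ ω, t A ω ∂μ).re) (fun A B => (∫ ω, t A ω * t B ω ∂μ).re) =
      2 * ∫ ω, (∑ A, m A * (t A ω).im) ^ 2 ∂μ := by
  rw [shorPairing_integral_conj_eq m₀ m hm hb, shorPairing_integral_eq m₀ m hm hb]
  ring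

end Measure

/-! ## Bootstrap functionals: `Q_{AB} = φ(a_A a_B + b_A b_B)` -/

section Functional

variable {R : Type*} [CommRing R] [Algebra ℝ R]

/-- `(Σ_A m_A • b_A)² = Σ_{A,B} (m_A m_B) • (b_A b_B)` in a commutative algebra. [folklore] -/
theorem sq_sum_smul_eq_sum_sum (m : ι → ℝ) (b : ι → R) :
    (∑ A, m A • b A) ^ 2 = ∑ A, ∑ B, (m A * m B) • (b A * b B) := by
  rw [sq, Finset.sum_mul_sum]
  exact Finset.sum_congr rfl fun A _ => Finset.sum_congr rfl fun B _ => by rw [smul_mul_smul_comm]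

/-- **The orientation-resolved block for a bootstrap functional**: for a linear `φ` on a commutative
`ℝ`-algebra with `φ 1 = 1`, "real parts" `a_A` and "imaginary parts" `b_A`, `W_A = φ a_A` and the
Hermitian pair variable `Q_{AB} = φ(a_A a_B + b_A b_B)` (`= φ Re(t_A conj t_B)`):
`⟨m mᵀ, Shor(W, Q)⟩ = φ((m₀ + Σ m_A a_A)²) + φ((Σ m_A b_A)²)`. [folklore] -/
theorem shorPairing_apply_conj_eq (φ : R →ₗ[ℝ] ℝ) (h1 : φ 1 = 1) (m₀ : ℝ) (m : ι → ℝ) (a b : ι → R) :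
    shorPairing m₀ m (fun A => φ (a A)) (fun A B => φ (a A * a B + b A * b B)) =
      φ ((algebraMap ℝ R m₀ + ∑ A, m A • a A) ^ 2) + φ ((∑ A, m A • b A) ^ 2) := by
  have hdiff := shorPairing_sub_shorPairing m₀ m (fun A => φ (a A)) (fun A B => φ (a A * a B + b A * b B))
    (fun A B => φ (a A * a B - b A * b B))
  have hsum : ∑ A, ∑ B, m A * m B * (φ (a A * a B + b A * b B) - φ (a A * a B - b A * b B)) =
      2 * φ ((∑ A, m A • b A) ^ 2) := by
    rw [sq_sum_smul_eq_sum_sum, map_sum, Finset.mul_sum]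
    refine Finset.sum_congr rfl fun A _ => ?_
    rw [map_sum, Finset.mul_sum]
    refine Finset.sum_congr rfl fun B _ => ?_
    rw [map_smul, smul_eq_mul, ← map_sub, show a A * a B + b A * b B - (a A * a B - b A * b B) = (2 : ℝ) • (b A * b B) by
      rw [two_smul]; ring, map_smul, smul_eq_mul]
    ring
  rw [hsum, shorPairing_apply_eq φ h1] at hdiff
  linarith

/-- **Hence for every linear functional non-negative on squares** (every feasible point of the
word-truncated bootstrap at a level containing the `a_A, b_A`): the orientation-resolved relaxation
block of its data is `≥ 0` — NO defect. [folklore] -/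
theorem shorPairing_apply_conj_nonneg (φ : R →ₗ[ℝ] ℝ) (h1 : φ 1 = 1) (m₀ : ℝ) (m : ι → ℝ) (a b : ι → R)
    (hsqa : 0 ≤ φ ((algebraMap ℝ R m₀ + ∑ A, m A • a A) ^ 2)) (hsqb : 0 ≤ φ ((∑ A, m A • b A) ^ 2)) :
    0 ≤ shorPairing m₀ m (fun A => φ (a A)) (fun A B => φ (a A * a B + b A * b B)) := by
  rw [shorPairing_apply_conj_eq φ h1]
  exact add_nonneg hsqa hsqb

end Functional

/-! ## Loop data on `ℤ^d`: the block read through the reversed second loop -/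

section Zd

variable {d N : ℕ} {G : Type*} [Group G] [TopologicalSpace G] [IsTopologicalGroup G] [CompactSpace G]
  [MeasurableSpace G] [BorelSpace G] (ρ : G →* Matrix (Fin N) (Fin N) ℂ)

/-- ★★ **THE ORIENTATION-RESOLVED RELAXATION BLOCK OF A STATE ON `ℤ^d` IS A SUM OF TWO SECOND
MOMENTS**: for loops `ℓ_A` closed at `x`, ANY probability measure, any compact `G`, continuous `ρ`,
`⟨m mᵀ, [[1, Wᵀ], [W, (Q(ℓ_A, ℓ_B⁻¹))_{AB}]]⟩ = E(m₀ + Σ_A m_A Re t_{ℓ_A})² + E(Σ_A m_A Im t_{ℓ_A})²`.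
[folklore] -/
theorem shorPairing_loopData_resolved_eq (hρ : Continuous ρ) (μ : Measure (LGConfig d G)) [IsProbabilityMeasure μ]
    (x : Site d) (ℓ : ι → Word d) (hℓ : ∀ A, Word.endpointZd x (ℓ A) = x) (m₀ : ℝ) (m : ι → ℝ) :
    shorPairing m₀ m (fun A => loopW ρ μ x (ℓ A)) (fun A B => loopQ ρ μ x (ℓ A) (ℓ B).reverse) =
      (∫ U, (m₀ + ∑ A, m A * (loopTrZd ρ x (ℓ A) U).re) ^ 2 ∂μ) +
        ∫ U, (∑ A, m A * (loopTrZd ρ x (ℓ A) U).im) ^ 2 ∂μ := by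
  have h : (fun A B => loopQ ρ μ x (ℓ A) (ℓ B).reverse) =
      fun A B => (∫ U, loopTrZd ρ x (ℓ A) U * starRingEnd ℂ (loopTrZd ρ x (ℓ B) U) ∂μ).re := by
    funext A B; exact loopQ_reverse_right ρ hρ μ x (ℓ A) (hℓ B)
  rw [h]
  exact shorPairing_integral_conj_eq m₀ m (t := fun A => loopTrZd ρ x (ℓ A))
    (fun A => aestronglyMeasurable_loopTrZd ρ hρ μ x (ℓ A)) (fun A U => norm_loopTrZd_le_one ρ hρ x (ℓ A) U)

/-- ★★ **Hence it is non-negative — at every `N`, every coupling, for every state.** [folklore] -/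
theorem shorPairing_loopData_resolved_nonneg (hρ : Continuous ρ) (μ : Measure (LGConfig d G)) [IsProbabilityMeasure μ]
    (x : Site d) (ℓ : ι → Word d) (hℓ : ∀ A, Word.endpointZd x (ℓ A) = x) (m₀ : ℝ) (m : ι → ℝ) :
    0 ≤ shorPairing m₀ m (fun A => loopW ρ μ x (ℓ A)) (fun A B => loopQ ρ μ x (ℓ A) (ℓ B).reverse) := by
  rw [shorPairing_loopData_resolved_eq ρ hρ μ x ℓ hℓ]
  exact add_nonneg (integral_nonneg fun U => sq_nonneg _) (integral_nonneg fun U => sq_nonneg _)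

/-- ★★ **KAZAKOV–ZHENG'S RELAXATION `[[1, Wᵀ], [W, Q]] ⪰ 0`, WIRED THROUGH THE REVERSED SECOND LOOP,
HOLDS EXACTLY FOR EVERY STATE ON `ℤ^d`** (any compact `G`, any continuous `ρ`, any probability
measure; loops closed at the base point). [folklore] -/
theorem isRelaxationFeasible_loopData_resolved (hρ : Continuous ρ) (μ : Measure (LGConfig d G)) [IsProbabilityMeasure μ]
    (x : Site d) (ℓ : ι → Word d) (hℓ : ∀ A, Word.endpointZd x (ℓ A) = x) :
    IsRelaxationFeasible (fun A => loopW ρ μ x (ℓ A)) (fun A B => loopQ ρ μ x (ℓ A) (ℓ B).reverse) :=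
  fun m₀ m => shorPairing_loopData_resolved_nonneg ρ hρ μ x ℓ hℓ m₀ m

/-- **The dictionary between the two wirings on a state's data**:
`⟨m mᵀ, Shor(W, Q(ℓ_A, ℓ_B⁻¹))⟩ − ⟨m mᵀ, Shor(W, Q(ℓ_A, ℓ_B))⟩ = 2 E(Σ_A m_A Im t_{ℓ_A})²` — the planar
wiring's defect (supplement 2, `shorPairing_loopData_ge`) is exactly this difference. [folklore] -/
theorem shorPairing_loopData_resolved_sub (hρ : Continuous ρ) (μ : Measure (LGConfig d G)) [IsProbabilityMeasure μ]
    (x : Site d) (ℓ : ι → Word d) (hℓ : ∀ A, Word.endpointZd x (ℓ A) = x) (m₀ : ℝ) (m : ι → ℝ) :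
    shorPairing m₀ m (fun A => loopW ρ μ x (ℓ A)) (fun A B => loopQ ρ μ x (ℓ A) (ℓ B).reverse) -
        shorPairing m₀ m (fun A => loopW ρ μ x (ℓ A)) (fun A B => loopQ ρ μ x (ℓ A) (ℓ B)) =
      2 * ∫ U, (∑ A, m A * (loopTrZd ρ x (ℓ A) U).im) ^ 2 ∂μ := by
  rw [shorPairing_loopData_resolved_eq ρ hρ μ x ℓ hℓ, shorPairing_loopData_eq ρ hρ μ x ℓ]
  ring

/-- The same difference written with the imaginary-part covariances:
`Σ_{A,B} m_A m_B (Q(ℓ_A, ℓ_B⁻¹) − Q(ℓ_A, ℓ_B)) = 2 Σ_{A,B} m_A m_B Γ(ℓ_A, ℓ_B)`. [folklore] -/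
theorem sum_sum_mul_loopQ_reverse_sub (hρ : Continuous ρ) (μ : Measure (LGConfig d G)) [IsFiniteMeasure μ]
    (x : Site d) (ℓ : ι → Word d) (hℓ : ∀ A, Word.endpointZd x (ℓ A) = x) (m : ι → ℝ) :
    ∑ A, ∑ B, m A * m B * (loopQ ρ μ x (ℓ A) (ℓ B).reverse - loopQ ρ μ x (ℓ A) (ℓ B)) =
      2 * ∑ A, ∑ B, m A * m B * loopImCov ρ μ x (ℓ A) (ℓ B) := by
  rw [Finset.mul_sum]
  refine Finset.sum_congr rfl fun A _ => ?_
  rw [Finset.mul_sum]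
  refine Finset.sum_congr rfl fun B _ => ?_
  rw [loopQ_reverse_sub_loopQ ρ hρ μ x (ℓ A) (hℓ B)]
  ring

end Zd

/-! ## Loop data on the torus `(ℤ/L)^d` (the cell's objects) -/

section Torus

variable {d L N : ℕ} {G : Type*} [Group G] [TopologicalSpace G] [IsTopologicalGroup G] [CompactSpace G]
  [MeasurableSpace G] [BorelSpace G] (ρ : G →* Matrix (Fin N) (Fin N) ℂ)

omit [BorelSpace G] in
/-- `Q(A, B⁻¹) = Re E[t_A conj t_B]` on the torus, for `B` closed at `x`. [folklore] -/
theorem loopQT_reverse_right (hρ : Continuous ρ) (μ : Measure (Literature.MathematicalPhysics.QuantumFieldTheory.GaugeConfig d L G)) (x : Literature.MathematicalPhysics.QuantumFieldTheory.Site d L) (A : Word d) {B : Word d}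
    (hB : Word.endpoint x B = x) :
    loopQT ρ μ x A B.reverse = (∫ U, loopTrT ρ x A U * starRingEnd ℂ (loopTrT ρ x B U) ∂μ).re := by
  rw [loopQT]
  congr 2
  funext U
  rw [loopTrT_reverse ρ hρ x hB]

/-- ★★ **The orientation-resolved relaxation block of a state on the torus is a sum of two second
moments**: `⟨m mᵀ, [[1, Wᵀ], [W, (Q(ℓ_A, ℓ_B⁻¹))]]⟩ = E(m₀ + Σ m_A Re t_{ℓ_A})² + E(Σ m_A Im t_{ℓ_A})²`
(loops closed at `x`; any probability measure on torus configurations). [folklore] -/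
theorem shorPairing_loopDataT_resolved_eq (hρ : Continuous ρ) (μ : Measure (Literature.MathematicalPhysics.QuantumFieldTheory.GaugeConfig d L G)) [IsProbabilityMeasure μ]
    (x : Literature.MathematicalPhysics.QuantumFieldTheory.Site d L) (ℓ : ι → Word d) (hℓ : ∀ A, Word.endpoint x (ℓ A) = x) (m₀ : ℝ) (m : ι → ℝ) :
    shorPairing m₀ m (fun A => loopWT ρ μ x (ℓ A)) (fun A B => loopQT ρ μ x (ℓ A) (ℓ B).reverse) =
      (∫ U, (m₀ + ∑ A, m A * (loopTrT ρ x (ℓ A) U).re) ^ 2 ∂μ) +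
        ∫ U, (∑ A, m A * (loopTrT ρ x (ℓ A) U).im) ^ 2 ∂μ := by
  have h : (fun A B => loopQT ρ μ x (ℓ A) (ℓ B).reverse) =
      fun A B => (∫ U, loopTrT ρ x (ℓ A) U * starRingEnd ℂ (loopTrT ρ x (ℓ B) U) ∂μ).re := by
    funext A B; exact loopQT_reverse_right ρ hρ μ x (ℓ A) (hℓ B)
  rw [h]
  exact shorPairing_integral_conj_eq m₀ m (t := fun A => loopTrT ρ x (ℓ A))
    (fun A => aestronglyMeasurable_loopTrT ρ hρ μ x (ℓ A)) (fun A U => norm_loopTrT_le_one ρ hρ x (ℓ A) U)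

/-- ★★ **Hence non-negative on every torus, every `N`, every `β`, every state.** [folklore] -/
theorem shorPairing_loopDataT_resolved_nonneg (hρ : Continuous ρ) (μ : Measure (Literature.MathematicalPhysics.QuantumFieldTheory.GaugeConfig d L G)) [IsProbabilityMeasure μ]
    (x : Literature.MathematicalPhysics.QuantumFieldTheory.Site d L) (ℓ : ι → Word d) (hℓ : ∀ A, Word.endpoint x (ℓ A) = x) (m₀ : ℝ) (m : ι → ℝ) :
    0 ≤ shorPairing m₀ m (fun A => loopWT ρ μ x (ℓ A)) (fun A B => loopQT ρ μ x (ℓ A) (ℓ B).reverse) := by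
  rw [shorPairing_loopDataT_resolved_eq ρ hρ μ x ℓ hℓ]
  exact add_nonneg (integral_nonneg fun U => sq_nonneg _) (integral_nonneg fun U => sq_nonneg _)

/-- ★★ **The orientation-resolved relaxation holds exactly for every state on every torus.** [folklore] -/
theorem isRelaxationFeasible_loopDataT_resolved (hρ : Continuous ρ) (μ : Measure (Literature.MathematicalPhysics.QuantumFieldTheory.GaugeConfig d L G)) [IsProbabilityMeasure μ]
    (x : Literature.MathematicalPhysics.QuantumFieldTheory.Site d L) (ℓ : ι → Word d) (hℓ : ∀ A, Word.endpoint x (ℓ A) = x) :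
    IsRelaxationFeasible (fun A => loopWT ρ μ x (ℓ A)) (fun A B => loopQT ρ μ x (ℓ A) (ℓ B).reverse) :=
  fun m₀ m => shorPairing_loopDataT_resolved_nonneg ρ hρ μ x ℓ hℓ m₀ m

end Torus

end Summit.QuantumFields.GaugeBoot

end
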